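import Summits.AtomisticToContinuum.Crystallization.Theorems.FrustratedLawDichotomyStrainedPatchHomSlopeCentre

/-!
# The CENTRED SLOPE LEAF `slopeCheckC` (ℓ² form) and its soundness in the `hG` shape of `hcpShifted_floor_W45`

decomp-a2c hand-1 g28 (crux `AperiodicFrustratedLawGap`, stmt-AtomisticToContinuum-27623; `(H) HomFloor (1/625)`, hcp half; lever (C), critic
row 1083 (B): the naive `slopeGs` of `…HomCurvLeafHC` is `≈ 3.3` at `2⁻⁹` boxes — `G²/(2λ)` swamps the margin; the TRUE gradient variation is `≈ 0.04`).
The gradient of the `B`-family energy in the shuffle, `g(U, ξ₀) = Σ_b β(‖c_b‖) c_b`, is expanded around the box-centre point `p_b = cenPt c b` of every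
CENTRED label (`…HomSlopeCentre.label_slope2`): value at the centre + first-order term `Σ_b h⁰_b d_b` (`h⁰_b = α₀ p_b p_bᵀ + β₀·1`, label sums BEFORE
absolute values, `d_b = (U − U_c)w_b + U(ξ₀ − ξ_c)` by `…HomCurvCentreKit.dVec_formula`) + second-order remainder; NAIVE labels keep the interval bound of
`slopeCheck2`.  Every piece is turned into an `ℓ²` bound against `‖Δ‖` (Cauchy–Schwarz), so the leaf's constant `Gs/SC` bounds `‖g‖₂`:

* §1 helpers (`abs_sum_mul_le_of_sq`, `norm_scaled_le_sqrtHi`, `linSlope_eq`, `mem_H0arr`);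
* §2 the kernel arrays `H0arr`, `Marr`, `Narr`, `Vvec`, `linS`, `G0arr`, `g0S`, `remSl`, `Gnarr`, `naiS` and ★ `slopeCheckC c w Lc Ln Gs`;
* §3 ★★★ `slope_bound_of_slopeCheckC` — EXACTLY the conclusion of `…HomCurvLeaf.slope_bound_of_slopeCheck2` with `L := Lc ++ Ln`:
  `|Σ_{b ∈ (Lc++Ln).toFinset} segG (deriv W₄₅) (latPt U hexFrame b + U(hcpShift + ξ₀)) (U(ξ − ξ₀)) 0| ≤ (Gs/SC)·‖U(ξ − ξ₀)‖`.

Kernel definitions + soundness; 0 sorry; standard axioms; no instances / notation / `#eval`.  `--supports stmt-AtomisticToContinuum-27623`.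
-/

noncomputable section

namespace Summit.AtomisticToContinuum.Crystallization.Theorems.FrustratedLawDichotomyStrainedPatchHomSlopeLeafC

open scoped BigOperators RealInnerProductSpace
open Literature.Analysis.ValidatedNumerics.Numerics
open Summit.AtomisticToContinuum.Crystallization.Theorems.ChargedEnergyGapNegative (E3)
open Summit.AtomisticToContinuum.Crystallization.Theorems.FrustratedLawDichotomySchurCut (effPot w₄₅ ω₄)
open Summit.AtomisticToContinuum.Crystallization.Theorems.FrustratedLawDichotomyStrainedPatchHomSplit (latPt hexFrame hcpShift)
open Summit.AtomisticToContinuum.Crystallization.Theorems.FrustratedLawDichotomyStrainedPatchHomEntryGram (entryFI mem_entryFI)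
open Summit.AtomisticToContinuum.Crystallization.Theorems.FrustratedLawDichotomyStrainedPatchHomEntryGramHcp (dot3 shufFI mem_dot3 mem_shufFI)
open Summit.AtomisticToContinuum.Crystallization.Theorems.FrustratedLawDichotomyStrainedPatchHomForceKit (vecB mem_vecB)
open Summit.AtomisticToContinuum.Crystallization.Theorems.FrustratedLawDichotomyStrainedPatchHomCurvCoeff (coeffFI2 mem_coeffFI2_beta)
open Summit.AtomisticToContinuum.Crystallization.Theorems.FrustratedLawDichotomyStrainedPatchHomCurvKit (accFI mem_accFI)
open Summit.AtomisticToContinuum.Crystallization.Theorems.FrustratedLawDichotomyStrainedPatchHomConvexCurvature (segG_zero_eq inner_eq_sum3 norm_sq_eq_sum)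
open Summit.AtomisticToContinuum.Crystallization.Theorems.FrustratedLawDichotomyStrainedPatchHomCurvCentre (pert_rearrange pert_abs_le norm_le_of_abs_le)
open Summit.AtomisticToContinuum.Crystallization.Theorems.FrustratedLawDichotomyStrainedPatchHomCurvCentreKit
open Summit.AtomisticToContinuum.Crystallization.Theorems.FrustratedLawDichotomyStrainedPatchHomCurvLeafL (A0of B0of naiveK rem_term_le)
open Summit.AtomisticToContinuum.Crystallization.Theorems.FrustratedLawDichotomyStrainedPatchHomSlopeCentre (slopeLabelOK KSlof label_slope2)
open Summit.AtomisticToContinuum.Crystallization.Theorems.FrustratedLawDichotomyStrainedPatchTaylorChord (segG)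
open Summit.AtomisticToContinuum.Crystallization.Theorems.FrustratedLawDichotomyStrainedPatchHomLatticeBoxHcp (norm_shifted_gt)

/-! ## §1. Helpers -/

/-- `|Σ_i X_i Δ_i| ≤ N‖Δ‖` whenever `Σ_i X_i² ≤ N²`, `0 ≤ N` (Cauchy–Schwarz in `ℝ³`). [folklore] -/
theorem abs_sum_mul_le_of_sq (X : Fin 3 → ℝ) (Δ : E3) {N : ℝ} (hN : 0 ≤ N) (hX : ∑ i, X i ^ 2 ≤ N ^ 2) :
    |∑ i, X i * Δ i| ≤ N * ‖Δ‖ := by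
  set v : E3 := (EuclideanSpace.equiv (Fin 3) ℝ).symm X with hv
  have hvi : ∀ i, v i = X i := fun i => rfl
  have hinner : ⟪v, Δ⟫ = ∑ i, X i * Δ i := by
    rw [inner_eq_sum3]
    exact Finset.sum_congr rfl fun i _ => by rw [hvi]
  have hnorm : ‖v‖ ≤ N := norm_le_of_abs_le v (fun i => |X i|) (fun i => by rw [hvi]) hN (by simpa [sq_abs] using hX)
  rw [← hinner]
  exact (abs_real_inner_le_norm v Δ).trans (mul_le_mul_of_nonneg_right hnorm (norm_nonneg _))

/-- Scaled form: `|X_i|·SC ≤ A_i` (integers) ⟹ `|Σ_i X_i Δ_i| ≤ ((FI.sqrt ⟨0, cdiv (Σ A_i²) SC⟩).hi / SC)·‖Δ‖`. [folklore] -/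
theorem abs_sum_mul_le_sqrtHi (X : Fin 3 → ℝ) (Δ : E3) (A : Fin 3 → ℤ) (h : ∀ i, |X i| * SC ≤ (A i : ℝ)) :
    |∑ i, X i * Δ i| ≤ ((FI.sqrt ⟨0, cdiv (∑ i, A i ^ 2) SC⟩).hi : ℝ) / SC * ‖Δ‖ := by
  have hS : (0 : ℝ) < SC := by norm_num [SC]
  set y : ℝ := ∑ i, X i ^ 2 with hy
  have hy0 : 0 ≤ y := Finset.sum_nonneg fun i _ => sq_nonneg _
  have hAi : ∀ i, X i ^ 2 ≤ ((A i : ℝ) / SC) ^ 2 := fun i => by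
    have : |X i| ≤ (A i : ℝ) / SC := by rw [le_div_iff₀ hS]; exact h i
    rw [← sq_abs]; exact pow_le_pow_left₀ (abs_nonneg _) this 2
  have h1 : y * SC ≤ ((∑ i, A i ^ 2 : ℤ) : ℝ) / SC := by
    have : y ≤ ∑ i, ((A i : ℝ) / SC) ^ 2 := Finset.sum_le_sum fun i _ => hAi i
    have e : (∑ i, ((A i : ℝ) / SC) ^ 2) * SC = ((∑ i, A i ^ 2 : ℤ) : ℝ) / SC := by
      push_cast; rw [Finset.sum_mul, Finset.sum_div]; exact Finset.sum_congr rfl fun i _ => by field_simp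
    calc y * SC ≤ (∑ i, ((A i : ℝ) / SC) ^ 2) * SC := mul_le_mul_of_nonneg_right this hS.le
      _ = _ := e
  have hcd := div_le_cdiv (a := ∑ i, A i ^ 2) (b := (SC : ℤ)) (by exact_mod_cast hS)
  have hcd' : ((∑ i, A i ^ 2 : ℤ) : ℝ) / SC ≤ ((cdiv (∑ i, A i ^ 2) SC : ℤ) : ℝ) := by exact_mod_cast hcd
  have hmem : FI.mem y ⟨0, cdiv (∑ i, A i ^ 2) SC⟩ := by
    refine ⟨?_, ?_⟩
    · push_cast; positivity
    · exact h1.trans hcd'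
  have hs := FI.mem_sqrt hmem
  have hN : Real.sqrt y ≤ ((FI.sqrt ⟨0, cdiv (∑ i, A i ^ 2) SC⟩).hi : ℝ) / SC := by rw [le_div_iff₀ hS]; exact hs.2
  have hN0 : 0 ≤ ((FI.sqrt ⟨0, cdiv (∑ i, A i ^ 2) SC⟩).hi : ℝ) / SC := (Real.sqrt_nonneg _).trans hN
  refine abs_sum_mul_le_of_sq X Δ hN0 ?_
  calc ∑ i, X i ^ 2 = Real.sqrt y ^ 2 := by rw [Real.sq_sqrt hy0]
    _ ≤ _ := pow_le_pow_left₀ (Real.sqrt_nonneg _) hN 2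

/-- Real centre array `h⁰_ki = α₀ p_k p_i + β₀ δ_ki`. -/
def H0r (α β : ℝ) (p : E3) (k i : Fin 3) : ℝ := α * (p k * p i) + (if k = i then β else 0)

/-- ★ The first-order slope term as `Σ_i (Σ_k d_k h⁰_ki) Δ_i`. [arithmetic] -/
theorem linSlope_eq (p d Δ : E3) (α β : ℝ) :
    α * ⟪p, d⟫ * ⟪p, Δ⟫ + β * ⟪d, Δ⟫ = ∑ i, (∑ k, d k * H0r α β p k i) * Δ i := by
  simp only [H0r, inner_eq_sum3, Fin.sum_univ_three]
  simp only [Fin.isValue, ↓reduceIte, show ((0 : Fin 3) = 1) = False by decide, show ((0 : Fin 3) = 2) = False by decide,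
    show ((1 : Fin 3) = 0) = False by decide, show ((1 : Fin 3) = 2) = False by decide, show ((2 : Fin 3) = 0) = False by decide,
    show ((2 : Fin 3) = 1) = False by decide]
  ring

/-! ## §2. The kernel arrays and the Boolean -/

/-- Kernel centre array `h⁰_b,ki` of a centred label. -/
def H0arr (c : (Fin 3 × Fin 3) ⊕ Fin 3 → ℤ) (b : Fin 3 → ℤ) (k i : Fin 3) : FI :=
  ((A0of c b).mul ((cenVec c b k).mul (cenVec c b i))).add (if k = i then B0of c b else FI.ofInt 0)

/-- ★ `H0arr` encloses `H0r` at the canonical centre values. [folklore] -/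
theorem mem_H0arr {c : (Fin 3 × Fin 3) ⊕ Fin 3 → ℤ} {b : Fin 3 → ℤ} {α β : ℝ} (hα : FI.mem α (A0of c b)) (hβ : FI.mem β (B0of c b))
    (k i : Fin 3) : FI.mem (H0r α β (cenPt c b) k i) (H0arr c b k i) := by
  have hz : FI.mem (0 : ℝ) (FI.ofInt 0) := by simpa using FI.mem_ofInt 0
  unfold H0r H0arr
  refine FI.mem_add (FI.mem_mul hα (FI.mem_mul (mem_cenVec c b k) (mem_cenVec c b i))) ?_
  split_ifs
  · exact hβ
  · exact hz

/-- First-order array `M_kl,i = Σ_{Lc} h⁰_b,ki (w_b)_l`. -/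
def Marr (c : (Fin 3 × Fin 3) ⊕ Fin 3 → ℤ) (Lc : List (Fin 3 → ℤ)) (k l i : Fin 3) : FI :=
  accFI Lc fun b => (H0arr c b k i).mul (wVec c b l)

/-- First-order array `N_k,i = Σ_{Lc} h⁰_b,ki`. -/
def Narr (c : (Fin 3 × Fin 3) ⊕ Fin 3 → ℤ) (Lc : List (Fin 3 → ℤ)) (k i : Fin 3) : FI := accFI Lc fun b => H0arr c b k i

/-- Scaled componentwise bound of the first-order term: `cdiv (Σ_kl w_kl·|M_kl,i| + Σ_k u_k·|N_k,i|) SC`. -/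
def Vvec (c w : (Fin 3 × Fin 3) ⊕ Fin 3 → ℤ) (Lc : List (Fin 3 → ℤ)) (i : Fin 3) : ℤ :=
  cdiv (∑ k : Fin 3, ∑ l : Fin 3, w (Sum.inl (k, l)) * (Marr c Lc k l i).absHi + ∑ k : Fin 3, uBound c w k * (Narr c Lc k i).absHi) SC

/-- Scaled `ℓ²` bound of the first-order term. -/
def linS (c w : (Fin 3 × Fin 3) ⊕ Fin 3 → ℤ) (Lc : List (Fin 3 → ℤ)) : ℤ := (FI.sqrt ⟨0, cdiv (∑ i : Fin 3, Vvec c w Lc i ^ 2) SC⟩).hi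

/-- Centre gradient `g⁰_i = Σ_{Lc} β₀_b (p_b)_i`. -/
def G0arr (c : (Fin 3 × Fin 3) ⊕ Fin 3 → ℤ) (Lc : List (Fin 3 → ℤ)) (i : Fin 3) : FI := accFI Lc fun b => (B0of c b).mul (cenVec c b i)

/-- Scaled `ℓ²` bound of the centre gradient. -/
def g0S (c : (Fin 3 × Fin 3) ⊕ Fin 3 → ℤ) (Lc : List (Fin 3 → ℤ)) : ℤ := (FI.sqrt ⟨0, cdiv (∑ i : Fin 3, (G0arr c Lc i).absHi ^ 2) SC⟩).hi

/-- Scaled second-order remainder `Σ_{Lc} cdiv(KSl_b·nd2S2_b, 2·SC)`. -/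
def remSl (c w : (Fin 3 × Fin 3) ⊕ Fin 3 → ℤ) (Lc : List (Fin 3 → ℤ)) : ℤ := (Lc.map fun b => cdiv (KSlof c w b * nd2S2 c w b) (2 * SC)).sum

/-- Naive gradient enclosure `Σ_{Ln} β_b·(C_b)_i` over the box (as in `slopeCheck2`). -/
def Gnarr (c w : (Fin 3 × Fin 3) ⊕ Fin 3 → ℤ) (Ln : List (Fin 3 → ℤ)) (i : Fin 3) : FI :=
  accFI Ln fun b => (((naiveK c w b).getD (FI.ofInt 0, FI.ofInt 0)).2).mul (vecB (boxE c w) (shufFI c w) b i)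

/-- Scaled `ℓ²` bound of the naive part. -/
def naiS (c w : (Fin 3 × Fin 3) ⊕ Fin 3 → ℤ) (Ln : List (Fin 3 → ℤ)) : ℤ :=
  (FI.sqrt ⟨0, cdiv (∑ i : Fin 3, (Gnarr c w Ln i).absHi ^ 2) SC⟩).hi

/-- ★ **THE CENTRED SLOPE CHECK** over the box `(c, w)`, centred labels `Lc`, naive labels `Ln`, bound `Gs/SC`. -/
def slopeCheckC (c w : (Fin 3 × Fin 3) ⊕ Fin 3 → ℤ) (Lc Ln : List (Fin 3 → ℤ)) (Gs : ℤ) : Bool :=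
  (Lc.all fun b => slopeLabelOK c w b) && (Ln.all fun b => (naiveK c w b).isSome) &&
    decide (g0S c Lc + linS c w Lc + remSl c w Lc + naiS c w Ln ≤ Gs)

/-- The computed bound the check compares against (so the check passes at this value whenever the label guards do). -/
def slopeGsC (c w : (Fin 3 × Fin 3) ⊕ Fin 3 → ℤ) (Lc Ln : List (Fin 3 → ℤ)) : ℤ := g0S c Lc + linS c w Lc + remSl c w Lc + naiS c w Ln

/-- `slopeCheckC` passes at the computed bound, given the guards. [formal bookkeeping] -/
theorem slopeCheckC_slopeGsC {c w : (Fin 3 × Fin 3) ⊕ Fin 3 → ℤ} {Lc Ln : List (Fin 3 → ℤ)}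
    (hc : (Lc.all fun b => slopeLabelOK c w b) = true) (hn : (Ln.all fun b => (naiveK c w b).isSome) = true) :
    slopeCheckC c w Lc Ln (slopeGsC c w Lc Ln) = true := by
  unfold slopeCheckC slopeGsC
  simp only [Bool.and_eq_true, decide_eq_true_eq]
  exact ⟨⟨hc, hn⟩, le_rfl⟩

/-! ## §3. ★★★ Soundness -/

/-- The remainder sum is below `remSl/SC`. [arithmetic] -/
theorem remSl_sum_le (c w : (Fin 3 × Fin 3) ⊕ Fin 3 → ℤ) {Lc : List (Fin 3 → ℤ)} (hLc : Lc.Nodup) :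
    ∑ b ∈ Lc.toFinset, (KSlof c w b : ℝ) / SC / 2 * ((nd2S2 c w b : ℝ) / SC) ≤ (remSl c w Lc : ℝ) / SC := by
  classical
  have h1 : ∑ b ∈ Lc.toFinset, (KSlof c w b : ℝ) / SC / 2 * ((nd2S2 c w b : ℝ) / SC) ≤
      ∑ b ∈ Lc.toFinset, ((cdiv (KSlof c w b * nd2S2 c w b) (2 * SC) : ℤ) : ℝ) / SC := Finset.sum_le_sum fun b _ => rem_term_le _ _
  refine h1.trans (le_of_eq ?_)
  rw [← Finset.sum_div]
  congr 1
  rw [List.sum_toFinset _ hLc, remSl, Int.cast_list_sum, List.map_map]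
  rfl

/-- ★★★ **SOUNDNESS OF THE CENTRED SLOPE LEAF.**  If `slopeCheckC c w Lc Ln Gs = true` (`Lc ++ Ln` duplicate-free) then for every `U` with entries in the
box and `‖U − 1‖ ≤ 1/4`, every shuffle `ξ₀` in the box with `‖ξ₀‖ ≤ 1/4` and every `ξ`:
`|Σ_{b ∈ (Lc++Ln).toFinset} segG (deriv W₄₅) (latPt U hexFrame b + U(hcpShift + ξ₀)) (U(ξ − ξ₀)) 0| ≤ (Gs/SC)·‖U(ξ − ξ₀)‖` — the `hG` input of
`…HomConvexSegmentW45.hcpShifted_floor_W45`, verbatim the conclusion of `…HomCurvLeaf.slope_bound_of_slopeCheck2`. [folklore chaining] -/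
theorem slope_bound_of_slopeCheckC {c w : (Fin 3 × Fin 3) ⊕ Fin 3 → ℤ} {Lc Ln : List (Fin 3 → ℤ)} (hL : (Lc ++ Ln).Nodup) {Gs : ℤ}
    (h : slopeCheckC c w Lc Ln Gs = true) (U : E3 →L[ℝ] E3) (hU : ‖U - 1‖ ≤ 1 / 4)
    (hbox : ∀ ab : Fin 3 × Fin 3, |(U (EuclideanSpace.single ab.2 (1 : ℝ))) ab.1 - (c (Sum.inl ab) : ℝ) / SC| ≤ (w (Sum.inl ab) : ℝ) / SC)
    (ξ₀ : E3) (hξ₀ : ∀ i : Fin 3, |ξ₀ i - (c (Sum.inr i) : ℝ) / SC| ≤ (w (Sum.inr i) : ℝ) / SC) (hn₀ : ‖ξ₀‖ ≤ 1 / 4) (ξ : E3) :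
    |∑ b ∈ (Lc ++ Ln).toFinset, segG (deriv (effPot w₄₅ ω₄ (3 / 400))) (latPt U hexFrame b + U (hcpShift + ξ₀)) (U (ξ - ξ₀)) 0| ≤
      (Gs : ℝ) / SC * ‖U (ξ - ξ₀)‖ := by
  classical
  have hS : (0 : ℝ) < SC := by norm_num [SC]
  unfold slopeCheckC at h
  simp only [Bool.and_eq_true, List.all_eq_true, decide_eq_true_eq] at h
  obtain ⟨⟨hcen, hnai⟩, hsum⟩ := h
  obtain ⟨hLc, hLn, hdisj⟩ := List.nodup_append.1 hL
  have hdisj' : List.Disjoint Lc Ln := fun a ha hb => hdisj a ha a hb rfl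
  set Δ : E3 := U (ξ - ξ₀) with hΔ
  set cb : (Fin 3 → ℤ) → E3 := fun b => latPt U hexFrame b + U (hcpShift + ξ₀) with hcb
  set βT : ℝ → ℝ := fun r => deriv (effPot w₄₅ ω₄ (3 / 400)) r / r with hβT
  set αT : ℝ → ℝ := fun r => (deriv (deriv (effPot w₄₅ ω₄ (3 / 400))) r - deriv (effPot w₄₅ ω₄ (3 / 400)) r / r) / r ^ 2 with hαT
  -- each summand is `βT‖c_b‖·⟪c_b, Δ⟫`
  have hsummand : ∀ b ∈ (Lc ++ Ln).toFinset, segG (deriv (effPot w₄₅ ω₄ (3 / 400))) (cb b) Δ 0 = βT ‖cb b‖ * ⟪cb b, Δ⟫ := by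
    intro b _; rw [segG_zero_eq]
  rw [Finset.sum_congr rfl hsummand, List.toFinset_append, Finset.sum_union (List.disjoint_toFinset_iff_disjoint.2 hdisj')]
  -- NAIVE part
  have hCn : ∀ (b : Fin 3 → ℤ) (a : Fin 3), FI.mem (cb b a) (vecB (boxE c w) (shufFI c w) b a) :=
    fun b a => mem_vecB U ξ₀ (fun ab => mem_entryFI (hbox ab)) (fun i => mem_shufFI (hξ₀ i)) b a
  have hQn : ∀ b : Fin 3 → ℤ, FI.mem (‖cb b‖ ^ 2) (dot3 (vecB (boxE c w) (shufFI c w) b) (vecB (boxE c w) (shufFI c w) b)) := by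
    intro b; rw [← real_inner_self_eq_norm_sq]; exact mem_dot3 (hCn b) (hCn b)
  have hρpos : ∀ b : Fin 3 → ℤ, 0 < ‖cb b‖ := fun b => lt_trans (by norm_num) (norm_shifted_gt hU hn₀ b)
  have hβn : ∀ b ∈ Ln, FI.mem (βT ‖cb b‖) ((naiveK c w b).getD (FI.ofInt 0, FI.ofInt 0)).2 := by
    intro b hb
    obtain ⟨AB, hAB⟩ := Option.isSome_iff_exists.1 (hnai b hb)
    have := mem_coeffFI2_beta (hρpos b) (hQn b) hAB
    have e : naiveK c w b = some AB := hAB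
    rw [e]; simpa using this
  have hNai : |∑ b ∈ Ln.toFinset, βT ‖cb b‖ * ⟪cb b, Δ⟫| ≤ (naiS c w Ln : ℝ) / SC * ‖Δ‖ := by
    have hre : ∑ b ∈ Ln.toFinset, βT ‖cb b‖ * ⟪cb b, Δ⟫ = ∑ i, (∑ b ∈ Ln.toFinset, βT ‖cb b‖ * cb b i) * Δ i := by
      calc ∑ b ∈ Ln.toFinset, βT ‖cb b‖ * ⟪cb b, Δ⟫ = ∑ b ∈ Ln.toFinset, ∑ i, βT ‖cb b‖ * cb b i * Δ i := by
            refine Finset.sum_congr rfl fun b _ => ?_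
            rw [inner_eq_sum3, Finset.mul_sum]
            exact Finset.sum_congr rfl fun i _ => by ring
        _ = ∑ i, ∑ b ∈ Ln.toFinset, βT ‖cb b‖ * cb b i * Δ i := Finset.sum_comm
        _ = ∑ i, (∑ b ∈ Ln.toFinset, βT ‖cb b‖ * cb b i) * Δ i := Finset.sum_congr rfl fun i _ => by rw [Finset.sum_mul]
    rw [hre]
    refine abs_sum_mul_le_sqrtHi _ Δ (fun i => (Gnarr c w Ln i).absHi) fun i => ?_
    exact FI.abs_le_absHi (mem_accFI Ln hLn fun b hb => FI.mem_mul (hβn b hb) (hCn b i))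
  -- CENTRED part: per-label expansions
  have hlf := fun b (hb : b ∈ Lc) => label_slope2 (hcen b hb) U hbox ξ₀ hξ₀ Δ
  set pc : (Fin 3 → ℤ) → E3 := fun b => cenPt c b with hpc
  -- (i) centre term
  have hG0 : |∑ b ∈ Lc.toFinset, βT ‖pc b‖ * ⟪pc b, Δ⟫| ≤ (g0S c Lc : ℝ) / SC * ‖Δ‖ := by
    have hre : ∑ b ∈ Lc.toFinset, βT ‖pc b‖ * ⟪pc b, Δ⟫ = ∑ i, (∑ b ∈ Lc.toFinset, βT ‖pc b‖ * pc b i) * Δ i := by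
      calc ∑ b ∈ Lc.toFinset, βT ‖pc b‖ * ⟪pc b, Δ⟫ = ∑ b ∈ Lc.toFinset, ∑ i, βT ‖pc b‖ * pc b i * Δ i := by
            refine Finset.sum_congr rfl fun b _ => ?_
            rw [inner_eq_sum3, Finset.mul_sum]
            exact Finset.sum_congr rfl fun i _ => by ring
        _ = ∑ i, ∑ b ∈ Lc.toFinset, βT ‖pc b‖ * pc b i * Δ i := Finset.sum_comm
        _ = ∑ i, (∑ b ∈ Lc.toFinset, βT ‖pc b‖ * pc b i) * Δ i := Finset.sum_congr rfl fun i _ => by rw [Finset.sum_mul]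
    rw [hre]
    refine abs_sum_mul_le_sqrtHi _ Δ (fun i => (G0arr c Lc i).absHi) fun i => ?_
    exact FI.abs_le_absHi (mem_accFI Lc hLc fun b hb => FI.mem_mul (hlf b hb).2.1 (mem_cenVec c b i))
  -- (ii) first-order term
  set X : Fin 3 → ℝ := fun i => ∑ b ∈ Lc.toFinset, ∑ k, (cb b - pc b) k * H0r (αT ‖pc b‖) (βT ‖pc b‖) (pc b) k i with hX
  have hlin_eq : ∑ b ∈ Lc.toFinset, (αT ‖pc b‖ * ⟪pc b, cb b - pc b⟫ * ⟪pc b, Δ⟫ + βT ‖pc b‖ * ⟪cb b - pc b, Δ⟫) = ∑ i, X i * Δ i := by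
    rw [Finset.sum_congr rfl fun b _ => linSlope_eq (pc b) (cb b - pc b) Δ (αT ‖pc b‖) (βT ‖pc b‖), Finset.sum_comm]
    refine Finset.sum_congr rfl fun i _ => ?_
    rw [hX, Finset.sum_mul]
  have hXb : ∀ i, |X i| * SC ≤ (Vvec c w Lc i : ℝ) := by
    intro i
    have hd : ∀ (b : Fin 3 → ℤ) (k : Fin 3), (cb b - pc b) k =
        ∑ l : Fin 3, ((U (EuclideanSpace.single l (1 : ℝ))) k - (c (Sum.inl (k, l)) : ℝ) / SC) * wPt c b l + (U (ξ₀ - cenShuf c)) k :=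
      fun b k => dVec_formula c U ξ₀ b k
    have hre : X i = ∑ k, ∑ l, ((U (EuclideanSpace.single l (1 : ℝ))) k - (c (Sum.inl (k, l)) : ℝ) / SC) *
        (∑ b ∈ Lc.toFinset, wPt c b l * H0r (αT ‖pc b‖) (βT ‖pc b‖) (pc b) k i) +
        ∑ k, (U (ξ₀ - cenShuf c)) k * ∑ b ∈ Lc.toFinset, H0r (αT ‖pc b‖) (βT ‖pc b‖) (pc b) k i := by
      rw [hX]
      simp only []
      rw [Finset.sum_congr rfl fun b _ => Finset.sum_congr rfl fun k _ => by rw [hd b k]]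
      exact pert_rearrange Lc.toFinset (fun k l => (U (EuclideanSpace.single l (1 : ℝ))) k - (c (Sum.inl (k, l)) : ℝ) / SC)
        (fun k => (U (ξ₀ - cenShuf c)) k) (fun b l => wPt c b l) (fun b k => H0r (αT ‖pc b‖) (βT ‖pc b‖) (pc b) k i)
    have hM : ∀ k l, FI.mem (∑ b ∈ Lc.toFinset, wPt c b l * H0r (αT ‖pc b‖) (βT ‖pc b‖) (pc b) k i) (Marr c Lc k l i) := by
      intro k l
      refine mem_accFI Lc hLc fun b hb => ?_
      rw [mul_comm]
      exact FI.mem_mul (mem_H0arr (hlf b hb).1 (hlf b hb).2.1 k i) (mem_wVec c b l)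
    have hN : ∀ k, FI.mem (∑ b ∈ Lc.toFinset, H0r (αT ‖pc b‖) (βT ‖pc b‖) (pc b) k i) (Narr c Lc k i) := by
      intro k
      exact mem_accFI Lc hLc fun b hb => mem_H0arr (hlf b hb).1 (hlf b hb).2.1 k i
    have habs := pert_abs_le (fun k l => (U (EuclideanSpace.single l (1 : ℝ))) k - (c (Sum.inl (k, l)) : ℝ) / SC)
      (fun k l => ∑ b ∈ Lc.toFinset, wPt c b l * H0r (αT ‖pc b‖) (βT ‖pc b‖) (pc b) k i) (fun k l => (w (Sum.inl (k, l)) : ℝ) / SC)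
      (fun k l => ((Marr c Lc k l i).absHi : ℝ) / SC) (fun k => (U (ξ₀ - cenShuf c)) k)
      (fun k => ∑ b ∈ Lc.toFinset, H0r (αT ‖pc b‖) (βT ‖pc b‖) (pc b) k i)
      (fun k => (uBound c w k : ℝ) / SC) (fun k => ((Narr c Lc k i).absHi : ℝ) / SC)
      (fun k l => hbox (k, l)) (fun k l => by rw [le_div_iff₀ hS]; exact FI.abs_le_absHi (hM k l))
      (fun k => by rw [le_div_iff₀ hS]; exact abs_shift_le U hbox ξ₀ hξ₀ k) (fun k => by rw [le_div_iff₀ hS]; exact FI.abs_le_absHi (hN k))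
    rw [← hre] at habs
    have hsum' : (∑ k : Fin 3, ∑ l : Fin 3, (w (Sum.inl (k, l)) : ℝ) / SC * (((Marr c Lc k l i).absHi : ℝ) / SC) +
        ∑ k : Fin 3, (uBound c w k : ℝ) / SC * (((Narr c Lc k i).absHi : ℝ) / SC)) * SC =
        ((∑ k : Fin 3, ∑ l : Fin 3, w (Sum.inl (k, l)) * (Marr c Lc k l i).absHi + ∑ k : Fin 3, uBound c w k * (Narr c Lc k i).absHi : ℤ) : ℝ) / SC := by
      push_cast
      rw [eq_div_iff hS.ne']
      simp only [add_mul, Finset.sum_mul]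
      congr 1
      · refine Finset.sum_congr rfl fun k _ => Finset.sum_congr rfl fun l _ => ?_
        field_simp
      · refine Finset.sum_congr rfl fun k _ => ?_
        field_simp
    have hcd := div_le_cdiv (a := ∑ k : Fin 3, ∑ l : Fin 3, w (Sum.inl (k, l)) * (Marr c Lc k l i).absHi +
      ∑ k : Fin 3, uBound c w k * (Narr c Lc k i).absHi) (b := (SC : ℤ)) (by exact_mod_cast hS)
    calc |X i| * SC ≤ _ := mul_le_mul_of_nonneg_right habs hS.le
      _ = _ := hsum'
      _ ≤ (Vvec c w Lc i : ℝ) := by rw [Vvec]; exact_mod_cast hcd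
  have hLin : |∑ i, X i * Δ i| ≤ (linS c w Lc : ℝ) / SC * ‖Δ‖ := abs_sum_mul_le_sqrtHi X Δ (fun i => Vvec c w Lc i) hXb
  -- (iii) remainders
  have hRem : |∑ b ∈ Lc.toFinset, (βT ‖cb b‖ * ⟪cb b, Δ⟫ - βT ‖pc b‖ * ⟪pc b, Δ⟫ -
      (αT ‖pc b‖ * ⟪pc b, cb b - pc b⟫ * ⟪pc b, Δ⟫ + βT ‖pc b‖ * ⟪cb b - pc b, Δ⟫))| ≤ (remSl c w Lc : ℝ) / SC * ‖Δ‖ := by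
    refine (Finset.abs_sum_le_sum_abs _ _).trans ?_
    have h1 : ∑ b ∈ Lc.toFinset, |βT ‖cb b‖ * ⟪cb b, Δ⟫ - βT ‖pc b‖ * ⟪pc b, Δ⟫ -
        (αT ‖pc b‖ * ⟪pc b, cb b - pc b⟫ * ⟪pc b, Δ⟫ + βT ‖pc b‖ * ⟪cb b - pc b, Δ⟫)| ≤
        ∑ b ∈ Lc.toFinset, (KSlof c w b : ℝ) / SC / 2 * ((nd2S2 c w b : ℝ) / SC) * ‖Δ‖ :=
      Finset.sum_le_sum fun b hb => (hlf b (List.mem_toFinset.1 hb)).2.2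
    refine h1.trans ?_
    rw [← Finset.sum_mul]
    exact mul_le_mul_of_nonneg_right (remSl_sum_le c w hLc) (norm_nonneg _)
  -- assemble the centred part
  have hCen : |∑ b ∈ Lc.toFinset, βT ‖cb b‖ * ⟪cb b, Δ⟫| ≤ ((g0S c Lc : ℝ) / SC + (linS c w Lc : ℝ) / SC + (remSl c w Lc : ℝ) / SC) * ‖Δ‖ := by
    have hsplit : ∑ b ∈ Lc.toFinset, βT ‖cb b‖ * ⟪cb b, Δ⟫ =
        ∑ b ∈ Lc.toFinset, βT ‖pc b‖ * ⟪pc b, Δ⟫ +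
        ∑ b ∈ Lc.toFinset, (αT ‖pc b‖ * ⟪pc b, cb b - pc b⟫ * ⟪pc b, Δ⟫ + βT ‖pc b‖ * ⟪cb b - pc b, Δ⟫) +
        ∑ b ∈ Lc.toFinset, (βT ‖cb b‖ * ⟪cb b, Δ⟫ - βT ‖pc b‖ * ⟪pc b, Δ⟫ -
          (αT ‖pc b‖ * ⟪pc b, cb b - pc b⟫ * ⟪pc b, Δ⟫ + βT ‖pc b‖ * ⟪cb b - pc b, Δ⟫)) := by
      rw [← Finset.sum_add_distrib, ← Finset.sum_add_distrib]
      exact Finset.sum_congr rfl fun b _ => by ring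
    rw [hsplit, hlin_eq]
    calc |∑ b ∈ Lc.toFinset, βT ‖pc b‖ * ⟪pc b, Δ⟫ + ∑ i, X i * Δ i +
          ∑ b ∈ Lc.toFinset, (βT ‖cb b‖ * ⟪cb b, Δ⟫ - βT ‖pc b‖ * ⟪pc b, Δ⟫ -
            (αT ‖pc b‖ * ⟪pc b, cb b - pc b⟫ * ⟪pc b, Δ⟫ + βT ‖pc b‖ * ⟪cb b - pc b, Δ⟫))|
        ≤ |∑ b ∈ Lc.toFinset, βT ‖pc b‖ * ⟪pc b, Δ⟫| + |∑ i, X i * Δ i| +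
          |∑ b ∈ Lc.toFinset, (βT ‖cb b‖ * ⟪cb b, Δ⟫ - βT ‖pc b‖ * ⟪pc b, Δ⟫ -
            (αT ‖pc b‖ * ⟪pc b, cb b - pc b⟫ * ⟪pc b, Δ⟫ + βT ‖pc b‖ * ⟪cb b - pc b, Δ⟫))| := abs_add_three _ _ _
      _ ≤ (g0S c Lc : ℝ) / SC * ‖Δ‖ + (linS c w Lc : ℝ) / SC * ‖Δ‖ + (remSl c w Lc : ℝ) / SC * ‖Δ‖ := by linarith [hG0, hLin, hRem]
      _ = _ := by ring
  -- total
  have hGs : (g0S c Lc : ℝ) / SC + (linS c w Lc : ℝ) / SC + (remSl c w Lc : ℝ) / SC + (naiS c w Ln : ℝ) / SC ≤ (Gs : ℝ) / SC := by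
    rw [← add_div, ← add_div, ← add_div]
    refine div_le_div_of_nonneg_right ?_ hS.le
    exact_mod_cast hsum
  have hΔ0 : 0 ≤ ‖Δ‖ := norm_nonneg _
  calc |∑ b ∈ Lc.toFinset, βT ‖cb b‖ * ⟪cb b, Δ⟫ + ∑ b ∈ Ln.toFinset, βT ‖cb b‖ * ⟪cb b, Δ⟫|
      ≤ |∑ b ∈ Lc.toFinset, βT ‖cb b‖ * ⟪cb b, Δ⟫| + |∑ b ∈ Ln.toFinset, βT ‖cb b‖ * ⟪cb b, Δ⟫| := abs_add_le _ _
    _ ≤ ((g0S c Lc : ℝ) / SC + (linS c w Lc : ℝ) / SC + (remSl c w Lc : ℝ) / SC) * ‖Δ‖ + (naiS c w Ln : ℝ) / SC * ‖Δ‖ := add_le_add hCen hNai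
    _ = ((g0S c Lc : ℝ) / SC + (linS c w Lc : ℝ) / SC + (remSl c w Lc : ℝ) / SC + (naiS c w Ln : ℝ) / SC) * ‖Δ‖ := by ring
    _ ≤ (Gs : ℝ) / SC * ‖Δ‖ := mul_le_mul_of_nonneg_right hGs hΔ0

end Summit.AtomisticToContinuum.Crystallization.Theorems.FrustratedLawDichotomyStrainedPatchHomSlopeLeafC

end
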